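import Mathlib

/-!
# conjb-1 (g2) — the SECULAR ROLLE step, proved (round 2, lead R1291: «type the resolvent identity as a first lemma»)

Seat `pub-symmetroid-conjb-1` (generation g2), bears_on V2.  HONEST FRAMING (tree port prepared by typer g7 for the wake, desk
R1317/R1320; author conjb-1 g2, bytes ea715f4d01db340d + namespace/docstrings only): an elementary Rolle-type lemma about
real polynomials, landed as a HELPER of the crux item `stmt-ValiantsHypothesis-18050` with no closure claim; it is vocabulary for
the cell's Conjecture-B programme (index-1 pivot pencils) and says nothing about `KPlusLogSqLaw`, `MatrixDescartes` or `VP ≠ VNP`.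

For real polynomials `N`, `D` with `D ≠ 0` on `(0, ∞)` (in the application `D = det P̃(x) > 0` and
`N = wᵀ adj P̃(x) w ≥ 0` are the two POSYNOMIALS of the index-1 pivot pencil `det (P̃(x) - x^e w wᵀ) = D - x^e N`),
the positive roots of `D - X^e N` are the solutions of `x^e N(x) / D(x) = 1`; between two of them Rolle gives a zero of
`(x^e N/D)' = x^{e-1} W_e(x) / D(x)^2`, where

  `W_e(N, D) := e·N·D + X·(N'·D - N·D')`     (the TWISTED WRONSKIAN; `W_e/(N D) = e + x (log N)' - x (log D)' = e - R`
                                              in the memo's notation, `R = x(log D)' - x(log N)'` the mean-frequency gap).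

Hence `Z₊(D - X^e N) ≤ 1 + Z₊(W_e(N, D))` (distinct positive roots), with the degenerate case `W_e = 0` included.
This is the polynomial clothing of «`Z₊ ≤ 1 + #{sign changes of R - e}`»; the memo (ROUND2-MEMO.md §1) integrates it over `e`.
-/

-- `Summit.ValiantsHypothesis.ValiantsHypothesis.…` repeats a component by the D-0017 layout
-- (single-conjunct summit), which the `dupNamespace` linter flags; the name is mandated.
set_option linter.dupNamespace false

namespace Summit.ValiantsHypothesis.ValiantsHypothesis.Theorems.LacunarySymmetroidMatrixDescartes.SecularRolle

open Polynomial Set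

/-- Number of distinct positive roots of a real polynomial (`0` for the zero polynomial, Mathlib convention) — the census currency `(f.roots.toFinset.filter (0 < ·)).card` under a name. [definition of the cell] -/
noncomputable def posRootCount (f : ℝ[X]) : ℕ := (f.roots.toFinset.filter (fun t => 0 < t)).card

/-- The twisted Wronskian `W_e(N, D) = e·N·D + X·(N'·D - N·D')`. [definition of the cell] -/
noncomputable def twistedWronskian (e : ℕ) (N D : ℝ[X]) : ℝ[X] :=
  C (e : ℝ) * (N * D) + X * (derivative N * D - N * derivative D)

/-- evaluation of the twisted Wronskian at a point. [folklore] -/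
theorem twistedWronskian_eval (e : ℕ) (N D : ℝ[X]) (x : ℝ) :
    (twistedWronskian e N D).eval x =
      e * (N.eval x * D.eval x) + x * ((derivative N).eval x * D.eval x - N.eval x * (derivative D).eval x) := by
  simp [twistedWronskian]

/-- `c · (e · c^(e-1)) = e · c^e` for natural `e` (both sides vanish at `e = 0`). -/
theorem mul_natCast_mul_pow_pred (c : ℝ) (e : ℕ) : c * ((e : ℝ) * c ^ (e - 1)) = (e : ℝ) * c ^ e := by
  rcases Nat.eq_zero_or_pos e with rfl | hpos
  · simp
  · obtain ⟨k, rfl⟩ := Nat.exists_eq_succ_of_ne_zero hpos.ne'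
    simp [pow_succ]; ring

/-- The secular function `x ↦ x^e N(x)/D(x)` has derivative `num(x)/D(x)²` wherever `D(x) ≠ 0`, and
`c · num(c) = c^e · W_e(c)`. -/
theorem hasDerivAt_secular (e : ℕ) (N D : ℝ[X]) {x : ℝ} (hx : D.eval x ≠ 0) :
    HasDerivAt (fun y : ℝ => y ^ e * N.eval y / D.eval y)
      ((((e : ℝ) * x ^ (e - 1) * N.eval x + x ^ e * (derivative N).eval x) * D.eval x
        - x ^ e * N.eval x * (derivative D).eval x) / D.eval x ^ 2) x := by
  have h1 : HasDerivAt (fun y : ℝ => y ^ e * N.eval y)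
      ((e : ℝ) * x ^ (e - 1) * N.eval x + x ^ e * (derivative N).eval x) x :=
    (hasDerivAt_pow e x).mul (N.hasDerivAt x)
  exact h1.div (D.hasDerivAt x) hx

/-- the numerator identity behind `(x^e N / D)' = x^{e-1} W_e(N,D) / D²`. [folklore] -/
theorem numerator_identity (e : ℕ) (N D : ℝ[X]) (c : ℝ) :
    c * ((((e : ℝ) * c ^ (e - 1) * N.eval c + c ^ e * (derivative N).eval c) * D.eval c
        - c ^ e * N.eval c * (derivative D).eval c))
      = c ^ e * (twistedWronskian e N D).eval c := by
  rw [twistedWronskian_eval]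
  have h := mul_natCast_mul_pow_pred c e
  linear_combination (N.eval c * D.eval c) * h

/-- **Rolle step.** Between two positive roots `a < b` of `D - X^e N` (with `D ≠ 0` on `(0,∞)`) lies a zero of `W_e(N,D)`. -/
theorem exists_root_twistedWronskian (e : ℕ) (N D : ℝ[X]) (hD : ∀ x : ℝ, 0 < x → D.eval x ≠ 0)
    {a b : ℝ} (ha : 0 < a) (hab : a < b)
    (hra : (D - X ^ e * N).eval a = 0) (hrb : (D - X ^ e * N).eval b = 0) :
    ∃ c ∈ Ioo a b, (twistedWronskian e N D).eval c = 0 := by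
  set f : ℝ → ℝ := fun y => y ^ e * N.eval y / D.eval y with hf
  have hval : ∀ z : ℝ, 0 < z → (D - X ^ e * N).eval z = 0 → f z = 1 := by
    intro z hz hrz
    have hDz := hD z hz
    simp only [eval_sub, eval_mul, eval_pow, eval_X] at hrz
    rw [hf, div_eq_one_iff_eq hDz]
    linarith
  have hcont : ContinuousOn f (Icc a b) := by
    apply ContinuousOn.div
    · exact ((continuous_pow e).mul N.continuous).continuousOn
    · exact D.continuousOn
    · intro x hx; exact hD x (ha.trans_le hx.1)
  have hderiv : ∀ x ∈ Ioo a b, HasDerivAt f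
      ((((e : ℝ) * x ^ (e - 1) * N.eval x + x ^ e * (derivative N).eval x) * D.eval x
        - x ^ e * N.eval x * (derivative D).eval x) / D.eval x ^ 2) x :=
    fun x hx => hasDerivAt_secular e N D (hD x (ha.trans hx.1))
  obtain ⟨c, hc, hc0⟩ :=
    exists_hasDerivAt_eq_zero hab hcont ((hval a ha hra).trans (hval b (ha.trans hab) hrb).symm) hderiv
  refine ⟨c, hc, ?_⟩
  have hc0' : 0 < c := ha.trans hc.1
  have hDc := hD c hc0'
  rcases (div_eq_zero_iff.mp hc0) with hnum | hden
  · have key := numerator_identity e N D c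
    rw [hnum, mul_zero] at key
    exact (mul_eq_zero.mp key.symm).resolve_left (pow_ne_zero e hc0'.ne')
  · exact absurd (pow_eq_zero_iff two_ne_zero |>.mp hden) hDc

/-- Degenerate case: if `W_e(N,D) = 0` then `D - X^e N` has at most one positive root
(the secular function is then constant on `(0,∞)`; a second root would force infinitely many). -/
theorem posRootCount_le_one_of_twistedWronskian_eq_zero (e : ℕ) (N D : ℝ[X])
    (hD : ∀ x : ℝ, 0 < x → D.eval x ≠ 0) (hW : twistedWronskian e N D = 0) :
    posRootCount (D - X ^ e * N) ≤ 1 := by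
  unfold posRootCount
  rcases eq_or_ne (D - X ^ e * N) 0 with h0 | h0
  · simp [h0]
  rw [Finset.card_le_one]
  intro a ha b hb
  simp only [Finset.mem_filter, Multiset.mem_toFinset, mem_roots h0, IsRoot.def] at ha hb
  by_contra hne
  -- wlog a < b
  wlog hlt : a < b generalizing a b
  · exact this b a hb ha (Ne.symm hne) (lt_of_le_of_ne (not_lt.mp hlt) (Ne.symm hne))
  -- every point of (a,b) is a root: MVT on [a,z]
  set f : ℝ → ℝ := fun y => y ^ e * N.eval y / D.eval y with hf
  have hval : ∀ z : ℝ, 0 < z → ((D - X ^ e * N).eval z = 0 ↔ f z = 1) := by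
    intro z hz
    have hDz := hD z hz
    simp only [eval_sub, eval_mul, eval_pow, eval_X]
    rw [hf, div_eq_one_iff_eq hDz]
    constructor <;> intro h <;> linarith
  have hroots : ∀ z ∈ Ioo a b, (D - X ^ e * N).eval z = 0 := by
    intro z hz
    have hz0 : 0 < z := ha.2.trans hz.1
    have hcont : ContinuousOn f (Icc a z) := by
      apply ContinuousOn.div
      · exact ((continuous_pow e).mul N.continuous).continuousOn
      · exact D.continuousOn
      · intro x hx; exact hD x (ha.2.trans_le hx.1)
    have hderiv : ∀ x ∈ Ioo a z, HasDerivAt f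
        ((((e : ℝ) * x ^ (e - 1) * N.eval x + x ^ e * (derivative N).eval x) * D.eval x
          - x ^ e * N.eval x * (derivative D).eval x) / D.eval x ^ 2) x :=
      fun x hx => hasDerivAt_secular e N D (hD x (ha.2.trans hx.1))
    obtain ⟨c, hc, hslope⟩ := exists_hasDerivAt_eq_slope f _ hz.1 hcont hderiv
    have hc0 : 0 < c := ha.2.trans hc.1
    -- the derivative vanishes at c because W_e = 0
    have hnum0 : (((e : ℝ) * c ^ (e - 1) * N.eval c + c ^ e * (derivative N).eval c) * D.eval c
          - c ^ e * N.eval c * (derivative D).eval c) = 0 := by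
      have key := numerator_identity e N D c
      rw [hW, eval_zero, mul_zero] at key
      exact (mul_eq_zero.mp key).resolve_left hc0.ne'
    rw [hnum0, zero_div] at hslope
    have hfa : f a = 1 := (hval a ha.2).mp ha.1
    have hfz : f z = 1 := by
      have hza : (z - a) ≠ 0 := sub_ne_zero.mpr (ne_of_gt hz.1)
      have : f z - f a = 0 := by
        have := hslope.symm
        rw [div_eq_zero_iff] at this
        exact this.resolve_right hza
      linarith
    exact (hval z hz0).mpr hfz
  apply h0
  apply Polynomial.eq_zero_of_infinite_isRoot
  exact Set.Infinite.mono (fun z hz => hroots z hz) (Set.Ioo_infinite hlt)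

/-- **SECULAR ROLLE (conjb-1 g2, Lemma 1.1 of ROUND2-MEMO.md).** For real polynomials `N, D` with `D ≠ 0` on `(0,∞)`:
`Z₊(D - X^e·N) ≤ Z₊(W_e(N,D)) + 1`, `W_e(N,D) = e·N·D + X·(N'·D - N·D')`. -/
theorem secularRolle (e : ℕ) (N D : ℝ[X]) (hD : ∀ x : ℝ, 0 < x → D.eval x ≠ 0) :
    posRootCount (D - X ^ e * N) ≤ posRootCount (twistedWronskian e N D) + 1 := by
  rcases eq_or_ne (twistedWronskian e N D) 0 with hW | hW
  · exact (posRootCount_le_one_of_twistedWronskian_eq_zero e N D hD hW).trans (by simp)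
  unfold posRootCount
  rcases eq_or_ne (D - X ^ e * N) 0 with h0 | h0
  · simp [h0]
  set s := (D - X ^ e * N).roots.toFinset.filter (fun t => 0 < t) with hs
  set t := (twistedWronskian e N D).roots.toFinset.filter (fun t => 0 < t) with ht
  calc s.card ≤ (t \ s).card + 1 := by
        refine Finset.card_le_sdiff_of_interleaved fun x hx y hy hxy _ => ?_
        simp only [hs, Finset.mem_filter, Multiset.mem_toFinset, mem_roots h0, IsRoot.def] at hx hy
        obtain ⟨z, hz, hz0⟩ := exists_root_twistedWronskian e N D hD hx.2 hxy hx.1 hy.1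
        refine ⟨z, ?_, hz.1, hz.2⟩
        simp only [ht, Finset.mem_filter, Multiset.mem_toFinset, mem_roots hW, IsRoot.def]
        exact ⟨hz0, hx.2.trans hz.1⟩
    _ ≤ t.card + 1 := by grw [Finset.sdiff_subset]

end Summit.ValiantsHypothesis.ValiantsHypothesis.Theorems.LacunarySymmetroidMatrixDescartes.SecularRolle
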